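import Summits.CriticalPhenomena.PercolationContinuityZ3.Theorems.PercNearOneGluingNoHeavyLowerTailFKQSensitivityWitnesses
import HarnessLib

/-!
# `q = 1/2`: the covariance transfer (K6) across a relay set FAILS — sharpness of `FK.covTransfer_relaySet_edge_rc`

Helper file (`--supports stmt-CriticalPhenomena-4575 --as helper`), FK sub-lane `prim-bschramm-fk-3` ("locate the `q`-sensitivity");
builds on p205010 (kernel theorem, internal audit signed; external expert review pending).  No named facts, no sorries; standard axioms;
exact rationals decided by the kernel through the bridge `FK.RCEval` (`…FKExactEval.lean`), on the data `QSensitivity.k3` of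
`…FKQSensitivityWitnesses.lean` (the triangle `K₃`, parameters `1/2`, `8` configurations).

(K6) — `CSH.covTransfer_relaySet_edge` at `q = 1`, `FK.covTransfer_relaySet_edge_rc` for `φ_{w,q}`, `q ≥ 1` (FKG + vdBHK Thm 2.1) — is the
covariance-transfer step of the conditioned slack hierarchy: for `x ∈ S`, `g` monotone, `m = E g(C_x)`, `D = {v ↮ S}`,
`φ(D ∩ {o↔v})·(∫_{v↔S} g(C_x) − φ(v↔S)·m) ≤ φ(D)·(∫_{o↔S} g(C_x) − φ(o↔S)·m)`.  bschramm/FK-BARRIER.md §6 records it census-TRUE for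
`q ≥ 1` (now a theorem) and census-FALSE at `q = 1/2` in every cell (ttrl cp-cshx engine B, 882/882 cells, `n ≤ 5`).  The kernel witness
(found by this seat's `work/k6search.py`, the simplest cell): `K₃`, parameters `1/2`, `q = 1/2`, `S = {0}`, `x = 0`, `o = 1`, `v = 2`,
`g = 1{02 ∈ C_0}` (`= 1{02 open}` on the cluster of `0`):
  `φ(2↮0, 1↔2) = 2/23`, `φ(2↮0) = 5/23`, `φ(2↔0) = φ(1↔0) = 18/23`, `m = ∫_{2↔0} g = 14/23`, `∫_{1↔0} g = 12/23`, so
  `LHS = (2/23)(14/23 − (18/23)(14/23)) = 140/12167 > RHS = (5/23)(12/23 − (18/23)(14/23)) = 120/12167`  (`FK.not_covTransfer_relaySet_edge_half`).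
So the hypothesis `1 ≤ q` of `FK.covTransfer_relaySet_edge_rc` is sharp, like those of `rcMeasureW_fkg`, `FK.clusterCPAFK_of_one_le`,
`rcMeasureW_real_mono_weights` and `FK.phiFKMonotone_of_one_le` (files `…FKQSensitivityWitnesses.lean`, `…FKPhiMonotoneSharpness.lean`).
[cite: VandenbergHaggstromKahn2005, Thm. 2.1 (p. 9), Thm. 1.4 (p. 7)] [cite: Grimmett2006, Thm. (3.8)(b) and §3.9]
-/

namespace Summit.CriticalPhenomena.PercolationContinuityZ3.Theorems

namespace FK

open MeasureTheory Literature.Probability.LatticeModels Literature.Probability.Percolation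

namespace QSensitivity

/-! ### Kernel arithmetic (`decide +kernel`, 8 configurations each; data `k3 (1/2)`, `Z = 23/64`) -/

/-- Mass of `{2 ↮ 0} ∩ {1 ↔ 2}`: `1/32` (probability `2/23`). (transcription of bschramm/FK-BARRIER.md §9) -/
theorem mass_half_D_ov :
    (k3 (1 / 2)).massQ (fun t => !((k3 (1 / 2)).reachB t 2 0) && (k3 (1 / 2)).reachB t 1 2) = 1 / 32 := by decide +kernel

/-- Mass of `{2 ↮ 0}`: `5/64` (probability `5/23`). (transcription of bschramm/FK-BARRIER.md §9) -/
theorem mass_half_D : (k3 (1 / 2)).massQ (fun t => !((k3 (1 / 2)).reachB t 2 0)) = 5 / 64 := by decide +kernel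

/-- Mass of `{2 ↔ 0}`: `9/32` (probability `18/23`). (transcription of bschramm/FK-BARRIER.md §9) -/
theorem mass_half_vS : (k3 (1 / 2)).massQ (fun t => (k3 (1 / 2)).reachB t 2 0) = 9 / 32 := by decide +kernel

/-- Mass of `{1 ↔ 0}`: `9/32` (probability `18/23`). (transcription of bschramm/FK-BARRIER.md §9) -/
theorem mass_half_oS : (k3 (1 / 2)).massQ (fun t => (k3 (1 / 2)).reachB t 1 0) = 9 / 32 := by decide +kernel

/-- Mass of `{2 ↔ 0} ∩ {02 open}`: `7/32` (`= ∫_{2↔0} g · Z`, probability `14/23`). (transcription of bschramm/FK-BARRIER.md §9) -/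
theorem mass_half_vS_g :
    (k3 (1 / 2)).massQ (fun t => (k3 (1 / 2)).reachB t 2 0 && decide ((1 : Fin 3) ∈ t)) = 7 / 32 := by decide +kernel

/-- Mass of `{1 ↔ 0} ∩ {02 open}`: `3/16` (`= ∫_{1↔0} g · Z`, probability `12/23`). (transcription of bschramm/FK-BARRIER.md §9) -/
theorem mass_half_oS_g :
    (k3 (1 / 2)).massQ (fun t => (k3 (1 / 2)).reachB t 1 0 && decide ((1 : Fin 3) ∈ t)) = 3 / 16 := by decide +kernel

/-! ### From masses to the measure -/

noncomputable section

open scoped Classical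

/-- The measure `φ = φ_{K₃, 1/2, q = 1/2}` of this file. [cite: Grimmett2006, §1.4 eq. (1.20) (p. 15)] -/
abbrev φhalf : Measure (BondConfig (Fin 3)) := rcMeasureW (k3 (1 / 2)).w (1 / 2) ∅

/-- `(k3 (1/2)).q = 1/2` as a real number. [folklore] -/
theorem k3_half_q : (((k3 (1 / 2)).q : ℚ) : ℝ) = 1 / 2 := by norm_num

/-- The relay event `{v ↔ S}` for `S = {0}`, `v = 2`, computed by `reachB`. [folklore] -/
theorem k3_conf_mem_vS (t : Finset (Fin 3)) :
    (k3 (1 / 2)).conf t ∈ (⋃ s ∈ ({0} : Finset (Fin 3)), openConn (2 : Fin 3) s) ↔ (k3 (1 / 2)).reachB t 2 0 = true := by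
  rw [RCEval.reachB_iff]
  simp only [Set.mem_iUnion, Finset.mem_singleton, exists_prop, exists_eq_left]
  rfl

/-- The relay event `{o ↔ S}` for `S = {0}`, `o = 1`, computed by `reachB`. [folklore] -/
theorem k3_conf_mem_oS (t : Finset (Fin 3)) :
    (k3 (1 / 2)).conf t ∈ (⋃ s ∈ ({0} : Finset (Fin 3)), openConn (1 : Fin 3) s) ↔ (k3 (1 / 2)).reachB t 1 0 = true := by
  rw [RCEval.reachB_iff]
  simp only [Set.mem_iUnion, Finset.mem_singleton, exists_prop, exists_eq_left]
  rfl

/-- The event `D = {v ↮ S}` for `S = {0}`, `v = 2`, computed by `reachB`. [folklore] -/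
theorem k3_conf_mem_D (t : Finset (Fin 3)) :
    (k3 (1 / 2)).conf t ∈ {ω : BondConfig (Fin 3) | ∀ s ∈ ({0} : Finset (Fin 3)), ¬ (openGraph ω).Reachable 2 s} ↔
      (!((k3 (1 / 2)).reachB t 2 0)) = true := by
  rw [Bool.not_eq_true', ← Bool.not_eq_true, RCEval.reachB_iff]
  simp only [Set.mem_setOf_eq, Finset.mem_singleton, forall_eq]

/-- The event `D ∩ {o ↔ v}`, computed by `reachB`. [folklore] -/
theorem k3_conf_mem_D_ov (t : Finset (Fin 3)) :
    (k3 (1 / 2)).conf t ∈ ({ω : BondConfig (Fin 3) | ∀ s ∈ ({0} : Finset (Fin 3)), ¬ (openGraph ω).Reachable 2 s} ∩ openConn 1 2) ↔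
      (!((k3 (1 / 2)).reachB t 2 0) && (k3 (1 / 2)).reachB t 1 2) = true := by
  rw [Set.mem_inter_iff, k3_conf_mem_D, Bool.and_eq_true, RCEval.reachB_iff]
  rfl

/-- `φ(D ∩ {1 ↔ 2}) = 2/23`. (transcription of bschramm/FK-BARRIER.md §9) -/
theorem real_half_D_ov :
    φhalf.real ({ω : BondConfig (Fin 3) | ∀ s ∈ ({0} : Finset (Fin 3)), ¬ (openGraph ω).Reachable 2 s} ∩ openConn 1 2) = 2 / 23 := by
  have h := RCEval.real_eq_massQ_div k3_half_valid k3_conf_mem_D_ov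
  rw [mass_half_D_ov, zq_half, k3_half_q] at h
  rw [h]; norm_num

/-- `φ(D) = 5/23`. (transcription of bschramm/FK-BARRIER.md §9) -/
theorem real_half_D : φhalf.real {ω : BondConfig (Fin 3) | ∀ s ∈ ({0} : Finset (Fin 3)), ¬ (openGraph ω).Reachable 2 s} = 5 / 23 := by
  have h := RCEval.real_eq_massQ_div k3_half_valid k3_conf_mem_D
  rw [mass_half_D, zq_half, k3_half_q] at h
  rw [h]; norm_num

/-- `φ(2 ↔ S) = 18/23`. (transcription of bschramm/FK-BARRIER.md §9) -/
theorem real_half_vS : φhalf.real (⋃ s ∈ ({0} : Finset (Fin 3)), openConn (2 : Fin 3) s) = 18 / 23 := by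
  have h := RCEval.real_eq_massQ_div k3_half_valid k3_conf_mem_vS
  rw [mass_half_vS, zq_half, k3_half_q] at h
  rw [h]; norm_num

/-- `φ(1 ↔ S) = 18/23`. (transcription of bschramm/FK-BARRIER.md §9) -/
theorem real_half_oS : φhalf.real (⋃ s ∈ ({0} : Finset (Fin 3)), openConn (1 : Fin 3) s) = 18 / 23 := by
  have h := RCEval.real_eq_massQ_div k3_half_valid k3_conf_mem_oS
  rw [mass_half_oS, zq_half, k3_half_q] at h
  rw [h]; norm_num

/-- The functional `g = 1{02 ∈ C}` of this file (increasing). [folklore] -/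
def g02 (C : Set (Sym2 (Fin 3))) : ℝ := if s((0 : Fin 3), 2) ∈ C then 1 else 0

/-- `g02` is monotone. [folklore] -/
theorem g02_mono : Monotone g02 := by
  intro S T hST
  unfold g02
  by_cases hS : s((0 : Fin 3), 2) ∈ S
  · rw [if_pos hS, if_pos (hST hS)]
  · rw [if_neg hS]; split_ifs <;> norm_num

/-- On `conf t`, `g02(C_0) = [02 open] = [1 ∈ t]`. [cite: VandenbergHaggstromKahn2005, §1 p. 3 (definition of C_s)] -/
theorem g02_conf (t : Finset (Fin 3)) :
    g02 (openEdgeCluster ((k3 (1 / 2)).conf t) 0) = if decide ((1 : Fin 3) ∈ t) then (1 : ℝ) else 0 := by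
  have h02 : s((0 : Fin 3), 2) ∈ openEdgeCluster ((k3 (1 / 2)).conf t) 0 ↔ decide ((1 : Fin 3) ∈ t) = true := by
    rw [mk_mem_openEdgeCluster_iff _ (by decide)]; exact k3_conf_mem_e1 k3_half_valid t
  unfold g02
  by_cases ht : decide ((1 : Fin 3) ∈ t) = true
  · rw [if_pos (h02.2 ht), if_pos ht]
  · rw [if_neg (fun h' => ht (h02.1 h')), if_neg ht]

/-- `m = ∫ g02(C_0) dφ = 14/23`. (transcription of bschramm/FK-BARRIER.md §9) -/
theorem integral_half_g : ∫ ω, g02 (openEdgeCluster ω 0) ∂φhalf = 14 / 23 := by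
  have h1 := RCEval.integral_eq_sum_div k3_half_valid (fun ω => g02 (openEdgeCluster ω 0))
  rw [k3_half_q] at h1
  rw [h1]
  simp only [g02_conf]
  rw [RCEval.sum_mQ_mul_ite (D := k3 (1 / 2)) (P := fun t => decide ((1 : Fin 3) ∈ t)), mass_half_e1, zq_half]
  norm_num

/-- A restricted integral of `g02(C_0)` as a mass: `∫_X g02(C_0) dφ = massQ (P ∧ [1 ∈ ·]) / ZQ` for `conf t ∈ X ↔ P t`. [folklore] -/
theorem setIntegral_half_g {X : Set (BondConfig (Fin 3))} {P : Finset (Fin 3) → Bool} (hP : ∀ t, (k3 (1 / 2)).conf t ∈ X ↔ P t = true) :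
    ∫ ω in X, g02 (openEdgeCluster ω 0) ∂φhalf =
      (((k3 (1 / 2)).massQ (fun t => P t && decide ((1 : Fin 3) ∈ t)) : ℚ) : ℝ) / (((k3 (1 / 2)).ZQ : ℚ) : ℝ) := by
  have h1 := RCEval.setIntegral_eq_sum_div k3_half_valid (fun ω => g02 (openEdgeCluster ω 0)) hP
  rw [k3_half_q] at h1
  rw [h1, ← RCEval.sum_mQ_mul_ite (D := k3 (1 / 2)) (P := fun t => P t && decide ((1 : Fin 3) ∈ t))]
  congr 1
  refine Finset.sum_congr rfl fun t _ => ?_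
  rw [g02_conf]
  cases P t <;> cases decide ((1 : Fin 3) ∈ t) <;> simp

/-- `∫_{2 ↔ S} g02(C_0) dφ = 14/23`. (transcription of bschramm/FK-BARRIER.md §9) -/
theorem setIntegral_half_vS_g : ∫ ω in (⋃ s ∈ ({0} : Finset (Fin 3)), openConn (2 : Fin 3) s), g02 (openEdgeCluster ω 0) ∂φhalf = 14 / 23 := by
  rw [setIntegral_half_g k3_conf_mem_vS, mass_half_vS_g, zq_half]; norm_num

/-- `∫_{1 ↔ S} g02(C_0) dφ = 12/23`. (transcription of bschramm/FK-BARRIER.md §9) -/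
theorem setIntegral_half_oS_g : ∫ ω in (⋃ s ∈ ({0} : Finset (Fin 3)), openConn (1 : Fin 3) s), g02 (openEdgeCluster ω 0) ∂φhalf = 12 / 23 := by
  rw [setIntegral_half_g k3_conf_mem_oS, mass_half_oS_g, zq_half]; norm_num

end

end QSensitivity

/-! ### The located statement -/

noncomputable section

open scoped Classical
open QSensitivity

/-- **(K6) FAILS for `φ_{w,q}` with `q = 1/2`**: the conclusion of `FK.covTransfer_relaySet_edge_rc` (covariance transfer across a relay set,
`q ≥ 1`) is false for `w` = parameters `1/2` on `K₃` and `q = 1/2`, at `S = {0}`, `x = 0`, `o = 1`, `v = 2`, `g = 1{02 ∈ C_0}`: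
`LHS = 140/12167 > RHS = 120/12167`.  So its hypothesis `1 ≤ q` is sharp (the CSH covariance-transfer device is a `q ≥ 1` phenomenon, as
the ttrl cp-cshx census of bschramm/FK-BARRIER.md §6 indicated: 882/882 cells negative at `q = 1/2`).
[cite: VandenbergHaggstromKahn2005, Thm. 2.1 (p. 9), Thm. 1.4 (p. 7)] [cite: Grimmett2006, Thm. (3.8)(b) and §3.9] -/
theorem not_covTransfer_relaySet_edge_half :
    ¬ ∀ (S : Finset (Fin 3)) (o v x : Fin 3), x ∈ S → ∀ g : Set (Sym2 (Fin 3)) → ℝ, Monotone g →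
      (rcMeasureW (k3 (1 / 2)).w (1 / 2) ∅).real ({ω : BondConfig (Fin 3) | ∀ t ∈ S, ¬ (openGraph ω).Reachable v t} ∩ openConn o v) *
          (∫ ω in (⋃ t ∈ S, openConn v t), g (openEdgeCluster ω x) ∂(rcMeasureW (k3 (1 / 2)).w (1 / 2) ∅) -
            (rcMeasureW (k3 (1 / 2)).w (1 / 2) ∅).real (⋃ t ∈ S, openConn v t) *
              ∫ ω, g (openEdgeCluster ω x) ∂(rcMeasureW (k3 (1 / 2)).w (1 / 2) ∅)) ≤
        (rcMeasureW (k3 (1 / 2)).w (1 / 2) ∅).real {ω : BondConfig (Fin 3) | ∀ t ∈ S, ¬ (openGraph ω).Reachable v t} *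
          (∫ ω in (⋃ t ∈ S, openConn o t), g (openEdgeCluster ω x) ∂(rcMeasureW (k3 (1 / 2)).w (1 / 2) ∅) -
            (rcMeasureW (k3 (1 / 2)).w (1 / 2) ∅).real (⋃ t ∈ S, openConn o t) *
              ∫ ω, g (openEdgeCluster ω x) ∂(rcMeasureW (k3 (1 / 2)).w (1 / 2) ∅)) := by
  intro h
  have key := h {0} 1 2 0 (Finset.mem_singleton_self 0) g02 g02_mono
  change φhalf.real _ * (∫ ω in _, g02 (openEdgeCluster ω 0) ∂φhalf - φhalf.real _ * ∫ ω, g02 (openEdgeCluster ω 0) ∂φhalf) ≤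
    φhalf.real _ * (∫ ω in _, g02 (openEdgeCluster ω 0) ∂φhalf - φhalf.real _ * ∫ ω, g02 (openEdgeCluster ω 0) ∂φhalf) at key
  rw [real_half_D_ov, real_half_D, real_half_vS, real_half_oS, setIntegral_half_vS_g, setIntegral_half_oS_g, integral_half_g] at key
  norm_num at key

end

end FK

end Summit.CriticalPhenomena.PercolationContinuityZ3.Theorems
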